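import Summits.AnomalousDissipation.AnomalousDissipation.Theorems.MomentParityCubicParityLoudDiagonalClassificationExtraction

/-!
# The symmetric and antisymmetric real forms of the single-triad identity

Helper file for stub `stub_diagonalClassification` (S3b) of the line `farkas-split-menu` of crux
`MomentParity.CubicParityLoud`.  The six-block identity `extraction` is specialised to the two
real test families of a triad `a + b = c`: REAL transversal amplitudes `u_a, u_b, u_c` (giving
the ANTISYMMETRIC identity, the one helicity solves) and the same with `u_a` replaced by
`i u_a` (giving the SYMMETRIC identity, the one energy solves).  With the real couplings
`Γ_a = (u_c·b) u_b − (u_b·a) u_c`, `Γ_b = (u_c·a) u_a − (u_a·b) u_c`, `Γ_c = (u_a·b) u_b + (u_b·a) u_a`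
and `P_k = leraySym k`, writing `σ_k(x, y) = Re⟪x, D k y⟫ + Re⟪y, D k x⟫`, they read
`Σ_{k∈{a,b,c}} (σ_k + σ_{−k})(P_k Γ_k, u_k) = 0` and
`(σ_a − σ_{−a})(i P_a Γ_a, u_a) + (σ_b − σ_{−b})(i P_b Γ_b, u_b) − (σ_c − σ_{−c})(i P_c Γ_c, u_c) = 0`.
-/

namespace Summit.AnomalousDissipation.AnomalousDissipation.Theorems.MomentParityCubicParityLoud

open Complex Finset Matrix
open scoped InnerProductSpace ComplexConjugate
open Literature.Analysis.FunctionSpaces Literature.Analysis.FluidPDE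

set_option linter.dupNamespace false

/-- Complexification of a real coordinate vector (local notation `cx u`). -/
local notation "cx" u:max => (WithLp.toLp 2 (fun i => (((u : Fin 3 → ℝ) i : ℝ) : ℂ)) : EuclideanSpace ℂ (Fin 3))

/-! ## Coordinate bookkeeping for complexified real vectors -/

/-- Coordinates of `cx u`. [folklore] -/
theorem cx_apply (u : Fin 3 → ℝ) (i : Fin 3) : (cx u) i = (u i : ℂ) := rfl

/-- `cx u` is real: `conj (cx u) = cx u`. [folklore] -/
theorem conjVec_cx (u : Fin 3 → ℝ) : EuclideanSpace.conjVec (cx u) = cx u := by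
  ext i; simp [EuclideanSpace.conjVec_apply]

/-- `conj (i • cx u) = −i • cx u`. [folklore] -/
theorem conjVec_I_smul_cx (u : Fin 3 → ℝ) : EuclideanSpace.conjVec (Complex.I • cx u) = (-Complex.I) • cx u := by
  rw [EuclideanSpace.conjVec_smul, conjVec_cx, Complex.conj_I]

/-- `cx` is additive. [folklore] -/
theorem cx_add (u v : Fin 3 → ℝ) : cx (u + v) = cx u + cx v := by
  ext i; simp []

/-- `cx` respects differences. [folklore] -/
theorem cx_sub (u v : Fin 3 → ℝ) : cx (u - v) = cx u - cx v := by
  ext i; simp []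

/-- `cx (s • u) = (s : ℂ) • cx u`. [folklore] -/
theorem cx_smul (s : ℝ) (u : Fin 3 → ℝ) : cx (s • u) = (s : ℂ) • cx u := by
  ext i; simp []

/-- The bilinear pairing of `cx u` with an integer frequency is the real dot product. [folklore] -/
theorem sum_cx_mul (u : Fin 3 → ℝ) (m : Fin 3 → ℤ) :
    ∑ x, (cx u) x * (m x : ℂ) = ((u ⬝ᵥ fun i => (m i : ℝ) : ℝ) : ℂ) := by
  simp [dotProduct]

/-- The same with a negated frequency. [folklore] -/
theorem sum_cx_mul_neg (u : Fin 3 → ℝ) (m : Fin 3 → ℤ) :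
    ∑ x, (cx u) x * -(m x : ℂ) = -((u ⬝ᵥ fun i => (m i : ℝ) : ℝ) : ℂ) := by
  rw [← sum_cx_mul, ← Finset.sum_neg_distrib]
  exact Finset.sum_congr rfl fun x _ => by ring

/-- The same with the (real) coordinates conjugated. [folklore] -/
theorem sum_conj_cx_mul (u : Fin 3 → ℝ) (m : Fin 3 → ℤ) :
    ∑ x, starRingEnd ℂ ((cx u) x) * (m x : ℂ) = ((u ⬝ᵥ fun i => (m i : ℝ) : ℝ) : ℂ) := by
  rw [← sum_cx_mul]
  exact Finset.sum_congr rfl fun x _ => by rw [cx_apply, Complex.conj_ofReal]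

/-- The same, conjugated coordinates and negated frequency. [folklore] -/
theorem sum_conj_cx_mul_neg (u : Fin 3 → ℝ) (m : Fin 3 → ℤ) :
    ∑ x, starRingEnd ℂ ((cx u) x) * -(m x : ℂ) = -((u ⬝ᵥ fun i => (m i : ℝ) : ℝ) : ℂ) := by
  rw [← sum_cx_mul_neg]
  exact Finset.sum_congr rfl fun x _ => by rw [cx_apply, Complex.conj_ofReal]

/-- Pairing of `i • cx u` with an integer frequency. [folklore] -/
theorem sum_I_cx_mul (u : Fin 3 → ℝ) (m : Fin 3 → ℤ) :
    ∑ x, (Complex.I • cx u) x * (m x : ℂ) = Complex.I * ((u ⬝ᵥ fun i => (m i : ℝ) : ℝ) : ℂ) := by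
  rw [← sum_cx_mul, Finset.mul_sum]
  exact Finset.sum_congr rfl fun x _ => by rw [PiLp.smul_apply, smul_eq_mul]; ring

/-- Conjugated pairing of `i • cx u` with an integer frequency. [folklore] -/
theorem sum_conj_I_cx_mul (u : Fin 3 → ℝ) (m : Fin 3 → ℤ) :
    ∑ x, starRingEnd ℂ ((Complex.I • cx u) x) * (m x : ℂ) = -Complex.I * ((u ⬝ᵥ fun i => (m i : ℝ) : ℝ) : ℂ) := by
  rw [← sum_cx_mul, Finset.mul_sum]
  exact Finset.sum_congr rfl fun x _ => by
    rw [PiLp.smul_apply, smul_eq_mul, map_mul, Complex.conj_I, cx_apply, Complex.conj_ofReal]; ring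

/-- Pairing of `i • cx u` with a negated integer frequency. [folklore] -/
theorem sum_I_cx_mul_neg (u : Fin 3 → ℝ) (m : Fin 3 → ℤ) :
    ∑ x, (Complex.I • cx u) x * -(m x : ℂ) = -(Complex.I * ((u ⬝ᵥ fun i => (m i : ℝ) : ℝ) : ℂ)) := by
  rw [← sum_I_cx_mul, ← Finset.sum_neg_distrib]
  exact Finset.sum_congr rfl fun x _ => by ring

/-- Conjugated pairing of `i • cx u` with a negated integer frequency. [folklore] -/
theorem sum_conj_I_cx_mul_neg (u : Fin 3 → ℝ) (m : Fin 3 → ℤ) :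
    ∑ x, starRingEnd ℂ ((Complex.I • cx u) x) * -(m x : ℂ) = Complex.I * ((u ⬝ᵥ fun i => (m i : ℝ) : ℝ) : ℂ) := by
  rw [← neg_neg (Complex.I * _), ← neg_mul, ← sum_conj_I_cx_mul, ← Finset.sum_neg_distrib]
  exact Finset.sum_congr rfl fun x _ => by ring

/-- The frequency pairing of `cx u` in the `k · v` convention of `Torus.IsTransversal`. [folklore] -/
theorem sum_intCast_mul_cx (m : Fin 3 → ℤ) (u : Fin 3 → ℝ) :
    ∑ j, (m j : ℂ) * (cx u) j = ((u ⬝ᵥ fun i => (m i : ℝ) : ℝ) : ℂ) := by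
  rw [← sum_cx_mul]; exact Finset.sum_congr rfl fun x _ => mul_comm _ _

/-- The same for `i • cx u`. [folklore] -/
theorem sum_intCast_mul_I_cx (m : Fin 3 → ℤ) (u : Fin 3 → ℝ) :
    ∑ j, (m j : ℂ) * (Complex.I • cx u) j = Complex.I * ((u ⬝ᵥ fun i => (m i : ℝ) : ℝ) : ℂ) := by
  rw [← sum_I_cx_mul]; exact Finset.sum_congr rfl fun x _ => mul_comm _ _

/-! ## The two real single-triad identities -/

/-- `2π ≠ 0`. [folklore] -/
theorem two_pi_ne_zero : (2 * Real.pi : ℝ) ≠ 0 := mul_ne_zero two_ne_zero Real.pi_ne_zero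

set_option maxHeartbeats 1600000 in
/-- **The antisymmetric single-triad identity** (real transversal amplitudes `u_a, u_b, u_c`):
`(σ_a − σ_{−a})(i P_a Γ_a, P_a u_a) + (σ_b − σ_{−b})(i P_b Γ_b, P_b u_b) − (σ_c − σ_{−c})(i P_c Γ_c, P_c u_c) = 0`,
`σ_k(x, y) = Re⟪x, D k y⟫ + Re⟪y, D k x⟫`. [folklore] -/
theorem extraction_A :
    ∀ (S : Finset (Fin 3 → ℤ)) (D : (Fin 3 → ℤ) → (EuclideanSpace ℂ (Fin 3) →ₗ[ℂ] EuclideanSpace ℂ (Fin 3))),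
    (∀ k ∈ S, -k ∈ S) →
    (∀ c : (Fin 3 → ℤ) → EuclideanSpace ℂ (Fin 3), (Torus.IsConjSymm c ∧ Torus.IsTransversal S c ∧
        ∀ k ∉ S, c k = 0) →
      ∑ k ∈ S, ((inner ℂ (Torus.leraySym k (Torus.convectionCoeff S c c k)) (D k (c k))).re +
        (inner ℂ (c k) (D k (Torus.leraySym k (Torus.convectionCoeff S c c k)))).re) = 0) →
    ∀ (a b c : Fin 3 → ℤ), a ∈ S → b ∈ S → c ∈ S → a + b = c → crossProduct a b ≠ 0 →
    ∀ (ua ub uc : Fin 3 → ℝ), ua ⬝ᵥ (fun i => (a i : ℝ)) = 0 → ub ⬝ᵥ (fun i => (b i : ℝ)) = 0 →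
      uc ⬝ᵥ (fun i => (c i : ℝ)) = 0 →
    ((inner ℂ (Complex.I • Torus.leraySym a (cx ((uc ⬝ᵥ (fun i => (b i : ℝ))) • ub - (ub ⬝ᵥ (fun i => (a i : ℝ))) • uc))) (D a (Torus.leraySym a (cx ua)))).re + (inner ℂ (Torus.leraySym a (cx ua)) (D a (Complex.I • Torus.leraySym a (cx ((uc ⬝ᵥ (fun i => (b i : ℝ))) • ub - (ub ⬝ᵥ (fun i => (a i : ℝ))) • uc))))).re
        - (inner ℂ (Complex.I • Torus.leraySym a (cx ((uc ⬝ᵥ (fun i => (b i : ℝ))) • ub - (ub ⬝ᵥ (fun i => (a i : ℝ))) • uc))) (D (-a) (Torus.leraySym a (cx ua)))).re - (inner ℂ (Torus.leraySym a (cx ua)) (D (-a) (Complex.I • Torus.leraySym a (cx ((uc ⬝ᵥ (fun i => (b i : ℝ))) • ub - (ub ⬝ᵥ (fun i => (a i : ℝ))) • uc))))).re)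
    + ((inner ℂ (Complex.I • Torus.leraySym b (cx ((uc ⬝ᵥ (fun i => (a i : ℝ))) • ua - (ua ⬝ᵥ (fun i => (b i : ℝ))) • uc))) (D b (Torus.leraySym b (cx ub)))).re + (inner ℂ (Torus.leraySym b (cx ub)) (D b (Complex.I • Torus.leraySym b (cx ((uc ⬝ᵥ (fun i => (a i : ℝ))) • ua - (ua ⬝ᵥ (fun i => (b i : ℝ))) • uc))))).re
        - (inner ℂ (Complex.I • Torus.leraySym b (cx ((uc ⬝ᵥ (fun i => (a i : ℝ))) • ua - (ua ⬝ᵥ (fun i => (b i : ℝ))) • uc))) (D (-b) (Torus.leraySym b (cx ub)))).re - (inner ℂ (Torus.leraySym b (cx ub)) (D (-b) (Complex.I • Torus.leraySym b (cx ((uc ⬝ᵥ (fun i => (a i : ℝ))) • ua - (ua ⬝ᵥ (fun i => (b i : ℝ))) • uc))))).re)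
    - ((inner ℂ (Complex.I • Torus.leraySym c (cx ((ua ⬝ᵥ (fun i => (b i : ℝ))) • ub + (ub ⬝ᵥ (fun i => (a i : ℝ))) • ua))) (D c (Torus.leraySym c (cx uc)))).re + (inner ℂ (Torus.leraySym c (cx uc)) (D c (Complex.I • Torus.leraySym c (cx ((ua ⬝ᵥ (fun i => (b i : ℝ))) • ub + (ub ⬝ᵥ (fun i => (a i : ℝ))) • ua))))).re
        - (inner ℂ (Complex.I • Torus.leraySym c (cx ((ua ⬝ᵥ (fun i => (b i : ℝ))) • ub + (ub ⬝ᵥ (fun i => (a i : ℝ))) • ua))) (D (-c) (Torus.leraySym c (cx uc)))).re - (inner ℂ (Torus.leraySym c (cx uc)) (D (-c) (Complex.I • Torus.leraySym c (cx ((ua ⬝ᵥ (fun i => (b i : ℝ))) • ub + (ub ⬝ᵥ (fun i => (a i : ℝ))) • ua))))).re) = 0 := by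
  intro S D hSsym hD a b c ha hb hc habc hab ua ub uc hua hub huc
  have key := extraction S D hSsym hD a b c ha hb hc habc hab (cx ua) (cx ub) (cx uc)
    (by rw [sum_intCast_mul_cx, hua]; simp) (by rw [sum_intCast_mul_cx, hub]; simp) (by rw [sum_intCast_mul_cx, huc]; simp)
  have hbc : ub ⬝ᵥ (fun i => (c i : ℝ)) = ub ⬝ᵥ (fun i => (a i : ℝ)) := by
    have e : (fun i => (c i : ℝ)) = (fun i => (a i : ℝ)) + (fun i => (b i : ℝ)) := by ext i; simp [← habc]
    rw [e, dotProduct_add, hub, add_zero]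
  have hac : ua ⬝ᵥ (fun i => (c i : ℝ)) = ua ⬝ᵥ (fun i => (b i : ℝ)) := by
    have e : (fun i => (c i : ℝ)) = (fun i => (a i : ℝ)) + (fun i => (b i : ℝ)) := by ext i; simp [← habc]
    rw [e, dotProduct_add, hua, zero_add]
  have hPa : Torus.leraySym a (cx ua) = cx ua := Torus.leraySym_of_transversal (by rw [sum_intCast_mul_cx, hua]; simp)
  have hPb : Torus.leraySym b (cx ub) = cx ub := Torus.leraySym_of_transversal (by rw [sum_intCast_mul_cx, hub]; simp)
  have hPc : Torus.leraySym c (cx uc) = cx uc := Torus.leraySym_of_transversal (by rw [sum_intCast_mul_cx, huc]; simp)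
  rw [hPa, hPb, hPc]
  simp only [conjVec_cx, sum_cx_mul, sum_cx_mul_neg, sum_conj_cx_mul, sum_conj_cx_mul_neg,
    hbc, hac, cx_add, cx_sub, cx_smul,
    Torus.leraySym_neg_freq, Torus.leraySym_add, Torus.leraySym_sub, Torus.leraySym_smul, 
    map_add, map_sub, map_smul,
    
    inner_add_left, inner_add_right, inner_sub_left, inner_sub_right, inner_smul_left, inner_smul_right
    ] at key ⊢
  simp only [map_mul, Complex.conj_ofReal, Complex.conj_I, map_neg, map_ofNat, Complex.add_re, Complex.sub_re,
    Complex.add_im, Complex.sub_im,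
    Complex.mul_re, Complex.mul_im, Complex.neg_re, Complex.ofReal_re, Complex.ofReal_im, Complex.I_re,
    Complex.I_im, Complex.re_ofNat, Complex.im_ofNat, mul_zero, zero_mul, sub_zero, zero_sub, add_zero, zero_add,
    mul_one, one_mul, neg_mul, mul_neg, neg_neg] at key ⊢
  refine mul_left_cancel₀ two_pi_ne_zero ?_
  rw [mul_zero]
  linear_combination (-1 : ℝ) * key

set_option maxHeartbeats 1600000 in
/-- **The symmetric single-triad identity** (amplitudes `i u_a, u_b, u_c`):
`Σ_{k∈{a,b,c}} (σ_k + σ_{−k})(P_k Γ_k, P_k u_k) = 0`. [folklore] -/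
theorem extraction_S :
    ∀ (S : Finset (Fin 3 → ℤ)) (D : (Fin 3 → ℤ) → (EuclideanSpace ℂ (Fin 3) →ₗ[ℂ] EuclideanSpace ℂ (Fin 3))),
    (∀ k ∈ S, -k ∈ S) →
    (∀ c : (Fin 3 → ℤ) → EuclideanSpace ℂ (Fin 3), (Torus.IsConjSymm c ∧ Torus.IsTransversal S c ∧
        ∀ k ∉ S, c k = 0) →
      ∑ k ∈ S, ((inner ℂ (Torus.leraySym k (Torus.convectionCoeff S c c k)) (D k (c k))).re +
        (inner ℂ (c k) (D k (Torus.leraySym k (Torus.convectionCoeff S c c k)))).re) = 0) →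
    ∀ (a b c : Fin 3 → ℤ), a ∈ S → b ∈ S → c ∈ S → a + b = c → crossProduct a b ≠ 0 →
    ∀ (ua ub uc : Fin 3 → ℝ), ua ⬝ᵥ (fun i => (a i : ℝ)) = 0 → ub ⬝ᵥ (fun i => (b i : ℝ)) = 0 →
      uc ⬝ᵥ (fun i => (c i : ℝ)) = 0 →
    ((inner ℂ (Torus.leraySym a (cx ((uc ⬝ᵥ (fun i => (b i : ℝ))) • ub - (ub ⬝ᵥ (fun i => (a i : ℝ))) • uc))) (D a (Torus.leraySym a (cx ua)))).re + (inner ℂ (Torus.leraySym a (cx ua)) (D a (Torus.leraySym a (cx ((uc ⬝ᵥ (fun i => (b i : ℝ))) • ub - (ub ⬝ᵥ (fun i => (a i : ℝ))) • uc))))).re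
        + (inner ℂ (Torus.leraySym a (cx ((uc ⬝ᵥ (fun i => (b i : ℝ))) • ub - (ub ⬝ᵥ (fun i => (a i : ℝ))) • uc))) (D (-a) (Torus.leraySym a (cx ua)))).re + (inner ℂ (Torus.leraySym a (cx ua)) (D (-a) (Torus.leraySym a (cx ((uc ⬝ᵥ (fun i => (b i : ℝ))) • ub - (ub ⬝ᵥ (fun i => (a i : ℝ))) • uc))))).re)
    + ((inner ℂ (Torus.leraySym b (cx ((uc ⬝ᵥ (fun i => (a i : ℝ))) • ua - (ua ⬝ᵥ (fun i => (b i : ℝ))) • uc))) (D b (Torus.leraySym b (cx ub)))).re + (inner ℂ (Torus.leraySym b (cx ub)) (D b (Torus.leraySym b (cx ((uc ⬝ᵥ (fun i => (a i : ℝ))) • ua - (ua ⬝ᵥ (fun i => (b i : ℝ))) • uc))))).re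
        + (inner ℂ (Torus.leraySym b (cx ((uc ⬝ᵥ (fun i => (a i : ℝ))) • ua - (ua ⬝ᵥ (fun i => (b i : ℝ))) • uc))) (D (-b) (Torus.leraySym b (cx ub)))).re + (inner ℂ (Torus.leraySym b (cx ub)) (D (-b) (Torus.leraySym b (cx ((uc ⬝ᵥ (fun i => (a i : ℝ))) • ua - (ua ⬝ᵥ (fun i => (b i : ℝ))) • uc))))).re)
    + ((inner ℂ (Torus.leraySym c (cx ((ua ⬝ᵥ (fun i => (b i : ℝ))) • ub + (ub ⬝ᵥ (fun i => (a i : ℝ))) • ua))) (D c (Torus.leraySym c (cx uc)))).re + (inner ℂ (Torus.leraySym c (cx uc)) (D c (Torus.leraySym c (cx ((ua ⬝ᵥ (fun i => (b i : ℝ))) • ub + (ub ⬝ᵥ (fun i => (a i : ℝ))) • ua))))).re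
        + (inner ℂ (Torus.leraySym c (cx ((ua ⬝ᵥ (fun i => (b i : ℝ))) • ub + (ub ⬝ᵥ (fun i => (a i : ℝ))) • ua))) (D (-c) (Torus.leraySym c (cx uc)))).re + (inner ℂ (Torus.leraySym c (cx uc)) (D (-c) (Torus.leraySym c (cx ((ua ⬝ᵥ (fun i => (b i : ℝ))) • ub + (ub ⬝ᵥ (fun i => (a i : ℝ))) • ua))))).re) = 0 := by
  intro S D hSsym hD a b c ha hb hc habc hab ua ub uc hua hub huc
  have key := extraction S D hSsym hD a b c ha hb hc habc hab (Complex.I • cx ua) (cx ub) (cx uc)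
    (by rw [sum_intCast_mul_I_cx, hua]; simp) (by rw [sum_intCast_mul_cx, hub]; simp) (by rw [sum_intCast_mul_cx, huc]; simp)
  have hbc : ub ⬝ᵥ (fun i => (c i : ℝ)) = ub ⬝ᵥ (fun i => (a i : ℝ)) := by
    have e : (fun i => (c i : ℝ)) = (fun i => (a i : ℝ)) + (fun i => (b i : ℝ)) := by ext i; simp [← habc]
    rw [e, dotProduct_add, hub, add_zero]
  have hac : ua ⬝ᵥ (fun i => (c i : ℝ)) = ua ⬝ᵥ (fun i => (b i : ℝ)) := by
    have e : (fun i => (c i : ℝ)) = (fun i => (a i : ℝ)) + (fun i => (b i : ℝ)) := by ext i; simp [← habc]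
    rw [e, dotProduct_add, hua, zero_add]
  have hPa : Torus.leraySym a (cx ua) = cx ua := Torus.leraySym_of_transversal (by rw [sum_intCast_mul_cx, hua]; simp)
  have hPb : Torus.leraySym b (cx ub) = cx ub := Torus.leraySym_of_transversal (by rw [sum_intCast_mul_cx, hub]; simp)
  have hPc : Torus.leraySym c (cx uc) = cx uc := Torus.leraySym_of_transversal (by rw [sum_intCast_mul_cx, huc]; simp)
  rw [hPa, hPb, hPc]
  simp only [conjVec_cx, conjVec_I_smul_cx, sum_cx_mul, sum_cx_mul_neg, sum_conj_cx_mul, sum_conj_cx_mul_neg,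
    sum_I_cx_mul, sum_conj_I_cx_mul, sum_I_cx_mul_neg, sum_conj_I_cx_mul_neg, hbc, hac, cx_add, cx_sub, cx_smul,
    Torus.leraySym_neg_freq, Torus.leraySym_add, Torus.leraySym_sub, Torus.leraySym_smul, Torus.leraySym_neg,
    map_add, map_sub, map_smul,
    smul_smul, neg_smul, smul_neg, map_neg, 
    inner_add_left, inner_add_right, inner_sub_left, inner_sub_right, inner_smul_left, inner_smul_right,
    inner_neg_left, inner_neg_right] at key ⊢
  simp only [map_mul, Complex.conj_ofReal, Complex.conj_I, map_neg, map_ofNat, Complex.add_re, Complex.sub_re,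
    Complex.add_im, 
    Complex.mul_re, Complex.mul_im, Complex.neg_re, Complex.neg_im, Complex.ofReal_re, Complex.ofReal_im, Complex.I_re,
    Complex.I_im, Complex.re_ofNat, Complex.im_ofNat, mul_zero, zero_mul, sub_zero, zero_sub, add_zero, zero_add,
    mul_one, one_mul, neg_mul, mul_neg, neg_neg, neg_zero] at key ⊢
  refine mul_left_cancel₀ two_pi_ne_zero ?_
  rw [mul_zero]
  linear_combination (-1 : ℝ) * key

end Summit.AnomalousDissipation.AnomalousDissipation.Theorems.MomentParityCubicParityLoud
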